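import Summits.MatrixMultiplication.OmegaCensus.SmallFormats.MatMul22nAllOnesRowTypes
import HarnessLib

/-!
# ω-census family (a): the structure of a `(0,1,1,2)`-pattern row over `𝔽₃` — the EMPTY cell's Gram block vanishes, and the single cells are rank one with prescribed shapes

Cell `pub-omega` (unit `pub-omega-tensor`, gen 42), topic `Summits/MatrixMultiplication/OmegaCensus` (sub-folder
`SmallFormats`). Framing (verbatim): lottery ticket; floor = certified bounds/negative ranges. HONEST FRAMING: the first new structural brick of the
KERNEL route to «K4 (the P2-type (8,27) kill-list marginal `Cover827.REP827 3`) is not an X-marginal» (memo HOME/pub-omega-tensor-g42/INVTEST-g42.md, route (A)):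
the `(Z,K,K,I)` row analysis of tensor g40's memo DEFLATION-g40 §7(b) (desk census `rowM2.py`, re-derived by this seat's `rowcensus.py`: 12 survivors, all of
the form (Z at the empty cell, I at the double cell, K κ₁ ≠ K κ₂ at the singles)) as abstract linear algebra, in the style of `AllOnesRowTypes.row_structure`.
* `ZKKIRow.empty_block_eq_zero` — a row cheap plane `span(c)` carrying FOUR linearly independent Y-forms, all outside a column plane `C` with cheap data
  `b` (`β.g t (ν ⊗ b m) = 0` off `C`): the Gram block `(c l ⬝ᵥ b m)` is ZERO. (Three of them make it singular by `AllOnesRow.gram_det_eq_zero`; if it were a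
  non-zero singular block with left null line `v`, the four coefficient matrices would lie in the 3-dimensional kernel of the cross functional `A ↦ (ν ᵥ* A) × v`.)
* `ZKKIRow.single_shape` — a single term whose row also meets an INVERTIBLE block (the double cell's column `D`, `det ≠ 0`, cheap for the term) and a
  singular non-zero block with left null representative `rep r` (column `S'`, cheap for the term), `D ≠ S'`: its coefficient matrix is
  `A q l = e · rep D q · rep r l` — BOTH Y-form rows lie on the kill vector `∑_l rep r l • c l`, with row weights `rep D` (image direction `m̂_D`).
Over `𝔽₃` (the finite shape lemma is `decide`d); any `n`, any index type. Nothing here is a bound on `ω`; nothing here mentions K4 yet.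
-/

namespace Summit.MatrixMultiplication.OmegaCensus.SmallFormats

open Finset Module Matrix
open Literature.Computability.AlgebraicComplexity

namespace ZKKIRow

variable {n : ℕ} {ι : Type*} [Fintype ι]

/-- Over `𝔽₃` a non-zero vector of length two is not isotropic: `x₀² + x₁² ≠ 0`. -/
theorem sq_add_sq_ne_zero (x : Fin 2 → ZMod 3) (hx : x ≠ 0) : x 0 * x 0 + x 1 * x 1 ≠ 0 := by
  revert x; decide

/-- **The EMPTY cell's Gram block vanishes.** If four terms with linearly independent Y-forms have their Y-form rows in `span(c)` and are all cheap for a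
column plane (`β.g t (ν ⊗ b m) = 0`, `ν ≠ 0`), then `c l ⬝ᵥ b m = 0` for all `l, m`. -/
theorem empty_block_eq_zero (β : BilinComp (mulBilin (ZMod 3) 2 2 n) ι) (ν : Fin 2 → ZMod 3) (hν : ν ≠ 0) (C : Finset ι)
    (b : Fin 2 → (Fin n → ZMod 3)) (hbch : ∀ t, t ∉ C → ∀ m, β.g t (Matrix.vecMulVec ν (b m)) = 0) (c : Fin 2 → (Fin n → ZMod 3))
    (t : Fin 4 → ι) (htC : ∀ i, t i ∉ C)
    (hrows : ∀ i (κ : Fin 2), ∃ a : Fin 2 → ZMod 3, (fun j => β.g (t i) (Matrix.single κ j (1 : ZMod 3))) = ∑ m, a m • c m)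
    (hind : LinearIndependent (ZMod 3) (fun i => β.g (t i))) :
    ∀ l m, c l ⬝ᵥ b m = 0 := by
  classical
  set P : Matrix (Fin 2) (Fin 2) (ZMod 3) := Matrix.of fun l m => c l ⬝ᵥ b m with hPdef
  by_contra hne
  push Not at hne
  obtain ⟨l₀, m₀, hl₀⟩ := hne
  have hP : P ≠ 0 := fun h => hl₀ (by have := congrFun (congrFun h l₀) m₀; simpa [hPdef] using this)
  -- three of the four terms make the block singular
  have hdet : P.det = 0 :=
    AllOnesRow.gram_det_eq_zero β ν hν C b hbch c (fun i : Fin 3 => t (Fin.castSucc i)) (fun i => htC _) (fun i κ => hrows _ κ)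
      (hind.comp _ (Fin.castSucc_injective 3))
  obtain ⟨v, hv, hvP⟩ := Matrix.exists_vecMul_eq_zero_iff.mpr hdet
  -- coefficient matrices
  have hA : ∀ i, ∃ A : Matrix (Fin 2) (Fin 2) (ZMod 3), ∀ κ, (fun j => β.g (t i) (Matrix.single κ j (1 : ZMod 3))) = ∑ l, A κ l • c l := by
    intro i
    choose a ha using hrows i
    exact ⟨Matrix.of fun κ l => a κ l, fun κ => ha κ⟩
  choose A hA using hA
  -- every `ν ᵥ* A i` is a left null vector of `P`, hence parallel to `v`
  have hpar : ∀ i, Matrix.vecMul ν (A i) 0 * v 1 - Matrix.vecMul ν (A i) 1 * v 0 = 0 := by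
    intro i
    have hnull : Matrix.vecMul (Matrix.vecMul ν (A i)) P = 0 := by
      funext m
      rw [hPdef, ← GramNondeg.g_cheapInput_eq_vecMul β (t i) c b ν (A i) (hA i) m, Pi.zero_apply]
      exact hbch (t i) (htC i) m
    exact F3Lines.leftNull_parallel P hP v _ hv hvP hnull
  -- the four coefficient matrices are linearly independent (their forms are) and lie in the kernel of a non-zero functional
  -- the Y-form with coefficient matrix `A'` in the frame `c`, linear in `A'`
  let Φ : Matrix (Fin 2) (Fin 2) (ZMod 3) →ₗ[ZMod 3] Module.Dual (ZMod 3) (Matrix (Fin 2) (Fin n) (ZMod 3)) :=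
    { toFun := fun A' =>
        { toFun := fun Y => ∑ q, ∑ j, (∑ l, A' q l * c l j) * Y q j
          map_add' := fun Y Y' => by simp only [Matrix.add_apply, mul_add, Finset.sum_add_distrib]
          map_smul' := fun s Y => by
            simp only [Matrix.smul_apply, smul_eq_mul, RingHom.id_apply, Finset.mul_sum]
            exact Finset.sum_congr rfl fun q _ => Finset.sum_congr rfl fun j _ => by ring }
      map_add' := fun A' A'' => by
        ext Y
        simp only [Matrix.add_apply, LinearMap.coe_mk, AddHom.coe_mk, LinearMap.add_apply, add_mul, Finset.sum_add_distrib]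
      map_smul' := fun s A' => by
        ext Y
        simp only [Matrix.smul_apply, smul_eq_mul, LinearMap.coe_mk, AddHom.coe_mk, RingHom.id_apply, LinearMap.smul_apply,
          Finset.mul_sum]
        exact Finset.sum_congr rfl fun q _ => Finset.sum_congr rfl fun j _ => by
          simp only [Finset.sum_mul, Finset.mul_sum]
          exact Finset.sum_congr rfl fun l _ => by ring }
  have hgi : ∀ i, β.g (t i) = Φ (A i) := by
    intro i
    ext Y
    rw [DoubleCellKill.g_eq_sum_rows]
    show ∑ q, ∑ j, (fun j => β.g (t i) (Matrix.single q j (1 : ZMod 3))) j * Y q j = ∑ q, ∑ j, (∑ l, A i q l * c l j) * Y q j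
    refine Finset.sum_congr rfl fun q _ => Finset.sum_congr rfl fun j _ => ?_
    have h := congrFun (hA i q) j
    simp only [Finset.sum_apply, Pi.smul_apply, smul_eq_mul] at h
    beta_reduce
    rw [h]
  have hAind : LinearIndependent (ZMod 3) A := by
    refine LinearIndependent.of_comp Φ ?_
    have : Φ ∘ A = fun i => β.g (t i) := by funext i; exact (hgi i).symm
    rw [this]; exact hind
  -- the cross functional `A' ↦ (ν ᵥ* A') × v`
  let χ : Matrix (Fin 2) (Fin 2) (ZMod 3) →ₗ[ZMod 3] ZMod 3 :=
    { toFun := fun A' => Matrix.vecMul ν A' 0 * v 1 - Matrix.vecMul ν A' 1 * v 0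
      map_add' := fun A' A'' => by simp only [Matrix.vecMul_add, Pi.add_apply]; ring
      map_smul' := fun s A' => by simp only [Matrix.vecMul_smul, Pi.smul_apply, smul_eq_mul, RingHom.id_apply]; ring }
  have hχ : χ (Matrix.vecMulVec ν ![v 1, -v 0]) ≠ 0 := by
    have hval : χ (Matrix.vecMulVec ν ![v 1, -v 0]) = (ν 0 * ν 0 + ν 1 * ν 1) * (v 0 * v 0 + v 1 * v 1) := by
      simp [χ, Matrix.vecMul, dotProduct, Fin.sum_univ_two]
      ring
    rw [hval]
    exact mul_ne_zero (sq_add_sq_ne_zero ν hν) (sq_add_sq_ne_zero v hv)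
  set K : Submodule (ZMod 3) (Matrix (Fin 2) (Fin 2) (ZMod 3)) := LinearMap.ker χ with hK
  have hmem : ∀ i, A i ∈ K := fun i => by rw [hK, LinearMap.mem_ker]; exact hpar i
  have hKlt : K < ⊤ := by
    refine lt_top_iff_ne_top.mpr fun htop => ?_
    have hin : Matrix.vecMulVec ν ![v 1, -v 0] ∈ K := by rw [htop]; exact Submodule.mem_top
    rw [hK, LinearMap.mem_ker] at hin
    exact hχ hin
  have hlt := Submodule.finrank_lt hKlt.ne
  have h4 : finrank (ZMod 3) (Matrix (Fin 2) (Fin 2) (ZMod 3)) = 4 := by rw [Module.finrank_matrix]; simp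
  have hli : LinearIndependent (ZMod 3) (fun i : Fin 4 => (⟨A i, hmem i⟩ : K)) :=
    LinearIndependent.of_comp K.subtype (by exact hAind)
  have hle := hli.fintype_card_le_finrank
  rw [Fintype.card_fin] at hle
  omega

set_option maxRecDepth 40000 in
/-- Finite shape lemma over `𝔽₃`: if `ν_D ᵥ* A = 0` and `ν_{S'} ᵥ* A` is parallel to `rep r`, `D ≠ S'`, then `A q l = e · rep D q · rep r l` for one scalar `e`. -/
theorem shape_of_null_and_parallel (Dc S' : Fin 4) (hDS : Dc ≠ S') (r : Fin 4) (A : Matrix (Fin 2) (Fin 2) (ZMod 3))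
    (hD : Matrix.vecMul (![-((![![1, 0], ![0, 1], ![1, 1], ![1, 2]] : Fin 4 → Fin 2 → ZMod 3) Dc 1), (![![1, 0], ![0, 1], ![1, 1], ![1, 2]] : Fin 4 → Fin 2 → ZMod 3) Dc 0] : Fin 2 → ZMod 3) A = 0)
    (hS : ((Matrix.vecMul (![-((![![1, 0], ![0, 1], ![1, 1], ![1, 2]] : Fin 4 → Fin 2 → ZMod 3) S' 1), (![![1, 0], ![0, 1], ![1, 1], ![1, 2]] : Fin 4 → Fin 2 → ZMod 3) S' 0] : Fin 2 → ZMod 3) A) 0 * ((![![1, 0], ![0, 1], ![1, 1], ![1, 2]] : Fin 4 → Fin 2 → ZMod 3) r) 1 - (Matrix.vecMul (![-((![![1, 0], ![0, 1], ![1, 1], ![1, 2]] : Fin 4 → Fin 2 → ZMod 3) S' 1), (![![1, 0], ![0, 1], ![1, 1], ![1, 2]] : Fin 4 → Fin 2 → ZMod 3) S' 0] : Fin 2 → ZMod 3) A) 1 * ((![![1, 0], ![0, 1], ![1, 1], ![1, 2]] : Fin 4 → Fin 2 → ZMod 3) r) 0) = 0) :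
    ∃ e : ZMod 3, ∀ q l, A q l = e * (![![1, 0], ![0, 1], ![1, 1], ![1, 2]] : Fin 4 → Fin 2 → ZMod 3) Dc q * (![![1, 0], ![0, 1], ![1, 1], ![1, 2]] : Fin 4 → Fin 2 → ZMod 3) r l := by
  revert Dc S' r A
  decide

/-- **Shape of a single cell in a `(Z,K,K,I)` row.** Let the term `t` have Y-form rows `∑_l A κ l • c l`, be cheap for the column `D` whose Gram block with `c` is
INVERTIBLE (the double cell's column) and for the column `S'` whose Gram block is non-zero and singular with left null representative `rep r` (the other
single's column), `D ≠ S'`. Then for one scalar `e`: `A q l = e · rep D q · rep r l` — both rows of `G_t` lie on the kill vector `∑_l rep r l • c l`. -/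
theorem single_shape (β : BilinComp (mulBilin (ZMod 3) 2 2 n) ι) (c : Fin 2 → (Fin n → ZMod 3)) (t : ι)
    (A : Matrix (Fin 2) (Fin 2) (ZMod 3)) (hA : ∀ κ : Fin 2, (fun j => β.g t (Matrix.single κ j (1 : ZMod 3))) = ∑ l, A κ l • c l)
    (Dc S' : Fin 4) (hDS : Dc ≠ S') (CD CS : Finset ι) (bD bS : Fin 2 → (Fin n → ZMod 3)) (htD : t ∉ CD) (htS : t ∉ CS)
    (hDch : ∀ t', t' ∉ CD → ∀ m, β.g t' (Matrix.vecMulVec (![-((![![1, 0], ![0, 1], ![1, 1], ![1, 2]] : Fin 4 → Fin 2 → ZMod 3) Dc 1), (![![1, 0], ![0, 1], ![1, 1], ![1, 2]] : Fin 4 → Fin 2 → ZMod 3) Dc 0] : Fin 2 → ZMod 3) (bD m)) = 0)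
    (hSch : ∀ t', t' ∉ CS → ∀ m, β.g t' (Matrix.vecMulVec (![-((![![1, 0], ![0, 1], ![1, 1], ![1, 2]] : Fin 4 → Fin 2 → ZMod 3) S' 1), (![![1, 0], ![0, 1], ![1, 1], ![1, 2]] : Fin 4 → Fin 2 → ZMod 3) S' 0] : Fin 2 → ZMod 3) (bS m)) = 0)
    (hDdet : (Matrix.of fun l m => c l ⬝ᵥ bD m : Matrix (Fin 2) (Fin 2) (ZMod 3)).det ≠ 0)
    (hSnz : (Matrix.of fun l m => c l ⬝ᵥ bS m : Matrix (Fin 2) (Fin 2) (ZMod 3)) ≠ 0) (r : Fin 4)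
    (hSr : Matrix.vecMul ((![![1, 0], ![0, 1], ![1, 1], ![1, 2]] : Fin 4 → Fin 2 → ZMod 3) r) (Matrix.of fun l m => c l ⬝ᵥ bS m) = 0) :
    ∃ e : ZMod 3, ∀ q l, A q l = e * (![![1, 0], ![0, 1], ![1, 1], ![1, 2]] : Fin 4 → Fin 2 → ZMod 3) Dc q * (![![1, 0], ![0, 1], ![1, 1], ![1, 2]] : Fin 4 → Fin 2 → ZMod 3) r l := by
  classical
  set rep : Fin 4 → Fin 2 → ZMod 3 := (![![1, 0], ![0, 1], ![1, 1], ![1, 2]] : Fin 4 → Fin 2 → ZMod 3) with hrep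
  have hrep_ne : ∀ j : Fin 4, rep j ≠ 0 := by rw [hrep]; decide
  -- column D: `ν_D ᵥ* A` is a left null vector of an invertible block, hence zero
  have hDnull : Matrix.vecMul (Matrix.vecMul ![-(rep Dc 1), rep Dc 0] A) (Matrix.of fun l m => c l ⬝ᵥ bD m) = 0 := by
    funext m
    rw [← GramNondeg.g_cheapInput_eq_vecMul β t c bD _ A hA m, Pi.zero_apply]
    exact hDch t htD m
  have hD0 : Matrix.vecMul ![-(rep Dc 1), rep Dc 0] A = 0 :=
    Matrix.eq_zero_of_vecMul_eq_zero hDdet hDnull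
  -- column S': `ν_{S'} ᵥ* A` is a left null vector of the singular block, hence parallel to `rep r`
  have hSnull : Matrix.vecMul (Matrix.vecMul ![-(rep S' 1), rep S' 0] A) (Matrix.of fun l m => c l ⬝ᵥ bS m) = 0 := by
    funext m
    rw [← GramNondeg.g_cheapInput_eq_vecMul β t c bS _ A hA m, Pi.zero_apply]
    exact hSch t htS m
  have hSpar := F3Lines.leftNull_parallel _ hSnz (rep r) _ (hrep_ne r) hSr hSnull
  exact shape_of_null_and_parallel Dc S' hDS r A (by rw [hrep] at hD0; exact hD0) (by rw [hrep] at hSpar; exact hSpar)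


/-- **The two single cells of a `(Z,K,K,I)` row have DIFFERENT null points (κ₁ ≠ κ₂).** If the single term `t` (own column `S₁`, block with left null
representative `rep r₁`) has the shape `A q l = e · rep D q · rep r₂ l` of `single_shape` (from the other single's column, null representative `rep r₂`),
then `r₁ ≠ r₂`: otherwise `t` would not see the cheap inputs of its own column (`ColumnSubcomp.sees_cheap_input`). -/
theorem null_reps_ne [DecidableEq ι] (β : BilinComp (mulBilin (ZMod 3) 2 2 n) ι) (c : Fin 2 → (Fin n → ZMod 3)) (t : ι)
    (A : Matrix (Fin 2) (Fin 2) (ZMod 3)) (hA : ∀ κ : Fin 2, (fun j => β.g t (Matrix.single κ j (1 : ZMod 3))) = ∑ l, A κ l • c l)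
    (S₁ : Fin 4) (CS : Finset ι) (hC4 : CS.card = 4) (bS : Fin 2 → (Fin n → ZMod 3))
    (hbi : ∀ a : Fin 2 → ZMod 3, ∑ m, a m • bS m = 0 → ∀ m, a m = 0)
    (hSch : ∀ t', t' ∉ CS → ∀ m, β.g t' (Matrix.vecMulVec (![-((![![1, 0], ![0, 1], ![1, 1], ![1, 2]] : Fin 4 → Fin 2 → ZMod 3) S₁ 1), (![![1, 0], ![0, 1], ![1, 1], ![1, 2]] : Fin 4 → Fin 2 → ZMod 3) S₁ 0] : Fin 2 → ZMod 3) (bS m)) = 0)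
    (ht : t ∈ CS) (Dc r₂ : Fin 4) (e : ZMod 3)
    (hshape : ∀ q l, A q l = e * (![![1, 0], ![0, 1], ![1, 1], ![1, 2]] : Fin 4 → Fin 2 → ZMod 3) Dc q * (![![1, 0], ![0, 1], ![1, 1], ![1, 2]] : Fin 4 → Fin 2 → ZMod 3) r₂ l)
    (r₁ : Fin 4) (hS1r : Matrix.vecMul ((![![1, 0], ![0, 1], ![1, 1], ![1, 2]] : Fin 4 → Fin 2 → ZMod 3) r₁) (Matrix.of fun l m => c l ⬝ᵥ bS m) = 0) :
    r₁ ≠ r₂ := by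
  classical
  set rep : Fin 4 → Fin 2 → ZMod 3 := (![![1, 0], ![0, 1], ![1, 1], ![1, 2]] : Fin 4 → Fin 2 → ZMod 3) with hrep
  intro heq
  subst heq
  have hnu : (![-(rep S₁ 1), rep S₁ 0] : Fin 2 → ZMod 3) ≠ 0 := by
    have h : ∀ j : Fin 4, (![-((![![1, 0], ![0, 1], ![1, 1], ![1, 2]] : Fin 4 → Fin 2 → ZMod 3) j 1), (![![1, 0], ![0, 1], ![1, 1], ![1, 2]] : Fin 4 → Fin 2 → ZMod 3) j 0] : Fin 2 → ZMod 3) ≠ 0 := by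
      decide
    exact h S₁
  obtain ⟨m, hm⟩ := ColumnSubcomp.sees_cheap_input β _ hnu CS hC4 bS hbi hSch t ht
  apply hm
  rw [GramNondeg.g_cheapInput_eq_vecMul β t c bS _ A hA m]
  -- `ν ᵥ* A = (e · (ν ⬝ rep D)) • rep r₁`, a left null vector of the own block
  have hνA : Matrix.vecMul ![-(rep S₁ 1), rep S₁ 0] A = (e * (![-(rep S₁ 1), rep S₁ 0] ⬝ᵥ rep Dc)) • rep r₁ := by
    funext l
    simp only [Matrix.vecMul, dotProduct, Fin.sum_univ_two, Pi.smul_apply, smul_eq_mul, hshape]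
    ring
  rw [hνA, Matrix.smul_vecMul, hS1r, smul_zero, Pi.zero_apply]

end ZKKIRow

end Summit.MatrixMultiplication.OmegaCensus.SmallFormats
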